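import Summits.QuantumFields.GaugeBoot.ClassB
import Literature.MathematicalPhysics.QuantumFieldTheory.SpeciesTimeReflection
import Literature.MathematicalPhysics.QuantumFieldTheory.LatticeGaugeStaticPotentialProofs
import HarnessLib

/-!
# Torus limit points are hyperoctahedrally invariant (gauge-boot, Class-B identification brick)

HONEST FRAMING (cell `pub-gaugeboot`, page 1 of every file): the venture produces certified bounds
on lattice expectations at stated coupling, gauge group, dimension and torus size; NOT a mass gap,
NOT a continuum limit, NOT a string tension; NOT Yang–Mills-summit-bearing (barriers
`FixedCouplingUltralocality`, `PerturbativeInvisibility`).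

Two more fields of `ClassBState` (`ClassB.lean`) hold for every infinite-volume limit point `μ` of
the torus Wilson states (`infiniteVolumeLimitPoints ρ β`), with the conventions of `ClassB.lean`:

* `permInvariant_of_mem_infiniteVolumeLimitPoints` — invariance under the axis permutations
  `configPerm σ` (`configPerm_eq_configPermZd`: `ClassB.lean`'s `configPerm σ` is the tree's
  `configPermZd σ`; the torus states are invariant under `configPerm` on `(ℤ/L)^d`,
  `wilsonExpectation_comp_configPerm`, and the periodic lift intertwines);
* `reflectInvariant_of_mem_infiniteVolumeLimitPoints` — invariance under the axis reflections
  `configSiteReflect i` (`x_i ↦ -x_i`, direction-`i` links reversed and inverted): for `i = 0` the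
  periodic lift intertwines `configSiteReflect 0` with the torus site reflection
  `GaugeConfig.negReflect` (`torusLift_negReflect`), under which the torus Wilson state is invariant
  for EVERY `L` (`integral_comp_negReflect_eq`, no parity condition); a general axis is conjugate to
  axis `0` by the transposition `(0 i)` (`configSiteReflect_eq_conj`).

In both cases `μ ∘ T⁻¹` is a limit of the SAME torus expectations along the same subsequence, and
bounded continuous cylinder integrals determine the measure (`measure_eq_of_integral_cylinder_eq`),
exactly as for translations (`isZdTranslationInvariant_of_mem_infiniteVolumeLimitPoints`, tree).
Together with `ClassBHaarShift.lean` this leaves, of the seven `ClassBState` fields of a torus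
limit point, the two reflection positivities (site, link: true on every torus, inheritance needs a
density argument not done here) and diagonal RP (`TorusLimitPointsDiagonalRP`, OPEN).

References: H.-O. Georgii, Gibbs Measures and Phase Transitions (2011) §§4.3, 5.1 (symmetries of
limit states); E. Seiler, LNP 159 (1982) Ch. 2.
-/

noncomputable section

open MeasureTheory Filter
open Literature.Probability.LatticeModels (Site Torus.proj)
open Literature.MathematicalPhysics.QuantumLattice
open Literature.MathematicalPhysics.QuantumFieldTheory (GaugeConfig wilsonExpectation configPermZd
  configPermZd_apply sitePermZd_apply toTorusObservable_comp_configPermZd continuous_configPermZd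
  wilsonExpectation_comp_configPerm measure_eq_of_integral_cylinder_eq integral_comp_negReflect_eq)

namespace Summit.QuantumFields.GaugeBoot

variable {d N : ℕ} {G : Type*} [Group G] [TopologicalSpace G] [IsTopologicalGroup G]
  [CompactSpace G] [MeasurableSpace G] [BorelSpace G]
variable (ρ : G →* Matrix (Fin N) (Fin N) ℂ)

/-! ## Axis permutations -/

section Perm

omit [Group G] [TopologicalSpace G] [IsTopologicalGroup G] [CompactSpace G] [BorelSpace G] in
/-- `ClassB.lean`'s axis permutation of configurations is the tree's `configPermZd`. -/
theorem configPerm_eq_configPermZd (σ : Equiv.Perm (Fin d)) :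
    configPerm (G := G) σ = ⇑(configPermZd (G := G) σ) := by
  funext U e
  rw [configPermZd_apply]
  simp only [configPerm]
  congr 2

variable [T2Space G] [SecondCountableTopology G]

/-- **Every torus limit point is invariant under the coordinate permutations** (as a measure
identity `μ ∘ (configPermZd π)⁻¹ = μ`). -/
theorem map_configPermZd_eq_of_mem_infiniteVolumeLimitPoints (hρ : Continuous ρ) {β : ℝ}
    {μ : Measure (LGConfig d G)} (hμ : μ ∈ infiniteVolumeLimitPoints (d := d) ρ β)
    (π : Equiv.Perm (Fin d)) : μ.map (configPermZd π) = μ := by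
  obtain ⟨φ, hφ, hprob, hconv⟩ := hμ
  haveI := hprob
  haveI : IsProbabilityMeasure (μ.map (configPermZd (G := G) π)) :=
    Measure.isProbabilityMeasure_map (configPermZd π).measurable.aemeasurable
  refine measure_eq_of_integral_cylinder_eq fun F S hFS hFc hFb => ?_
  rw [integral_map_equiv]
  have h1 := hconv (F ∘ configPermZd π) _
    (Literature.MathematicalPhysics.QuantumFieldTheory.IsCylinder.comp_configPermZd hFS π)
    (hFc.comp (continuous_configPermZd π))
    (by obtain ⟨C, hC⟩ := hFb; exact ⟨C, fun U => hC _⟩)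
  have hE : ∀ k : ℕ, wilsonExpectation (L := φ k + 1) ρ β
      (toTorusObservable (φ k + 1) (F ∘ configPermZd π)) =
      wilsonExpectation (L := φ k + 1) ρ β (toTorusObservable (φ k + 1) F) := fun k => by
    rw [toTorusObservable_comp_configPermZd, wilsonExpectation_comp_configPerm ρ hρ]
  simp only [hE] at h1
  exact tendsto_nhds_unique h1 (hconv F S hFS hFc hFb)

/-- **`permInvariant` for torus limit points**: every infinite-volume limit point of the torus
Wilson states is invariant under the axis permutations `configPerm σ` of `ClassB.lean`. -/
theorem permInvariant_of_mem_infiniteVolumeLimitPoints (hρ : Continuous ρ) {β : ℝ}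
    {μ : Measure (LGConfig d G)} (hμ : μ ∈ infiniteVolumeLimitPoints (d := d) ρ β)
    (σ : Equiv.Perm (Fin d)) : MeasurePreserving (configPerm σ) μ μ := by
  rw [configPerm_eq_configPermZd]
  exact ⟨(configPermZd σ).measurable, map_configPermZd_eq_of_mem_infiniteVolumeLimitPoints ρ hρ hμ σ⟩

end Perm

/-! ## Axis reflections -/

section Reflect

omit [TopologicalSpace G] [IsTopologicalGroup G] [CompactSpace G] [MeasurableSpace G] [BorelSpace G] in
/-- The edge under a reflected link: `configSiteReflect i U e` reads `U` at `siteReflectEdge i e`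
(inverted if `e.2 = i`). -/
theorem configSiteReflect_apply (i : Fin d) (U : LGConfig d G) (e : ZdEdge d) :
    configSiteReflect i U e = if e.2 = i then (U (zdSiteReflect i e.1 - Pi.single i 1, i))⁻¹
      else U (zdSiteReflect i e.1, e.2) := rfl

omit [CompactSpace G] [MeasurableSpace G] [BorelSpace G] in
/-- The axis reflection of configurations is continuous. -/
theorem continuous_configSiteReflect (i : Fin d) :
    Continuous (configSiteReflect (G := G) i : LGConfig d G → LGConfig d G) := by
  refine continuous_pi fun e => ?_
  by_cases he : e.2 = i
  · simp only [configSiteReflect, he, ↓reduceIte]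
    exact (continuous_apply _).inv
  · simp only [configSiteReflect, he, ↓reduceIte]
    exact continuous_apply _

omit [CompactSpace G] in
/-- The axis reflection of configurations is measurable. -/
theorem measurable_configSiteReflect [SecondCountableTopology G] (i : Fin d) :
    Measurable (configSiteReflect (G := G) i : LGConfig d G → LGConfig d G) := by
  refine measurable_pi_lambda _ fun e => ?_
  by_cases he : e.2 = i
  · simp only [configSiteReflect, he, ↓reduceIte]
    exact (measurable_pi_apply _).inv
  · simp only [configSiteReflect, he, ↓reduceIte]
    exact measurable_pi_apply _

omit [TopologicalSpace G] [IsTopologicalGroup G] [CompactSpace G] [MeasurableSpace G] [BorelSpace G] in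
/-- A cylinder observable stays a cylinder observable under an axis reflection (support: the
reflected links). -/
theorem isCylinder_comp_configSiteReflect {α : Type*} {F : LGConfig d G → α} {S : Finset (ZdEdge d)}
    (hF : IsCylinder F S) (i : Fin d) :
    IsCylinder (F ∘ configSiteReflect i)
      (S.image fun e => if e.2 = i then (zdSiteReflect i e.1 - Pi.single i 1, i)
        else (zdSiteReflect i e.1, e.2)) := by
  intro U V hUV
  apply hF
  intro e he
  have key : ∀ e' : ZdEdge d, e' ∈ S → U (if e'.2 = i then (zdSiteReflect i e'.1 - Pi.single i 1, i)
      else (zdSiteReflect i e'.1, e'.2)) = V (if e'.2 = i then (zdSiteReflect i e'.1 - Pi.single i 1, i)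
      else (zdSiteReflect i e'.1, e'.2)) := fun e' he' =>
    hUV _ (Finset.mem_coe.2 (Finset.mem_image_of_mem _ he'))
  have h := key e (Finset.mem_coe.1 he)
  simp only [configSiteReflect_apply]
  by_cases he2 : e.2 = i
  · rw [if_pos he2] at h; rw [if_pos he2, if_pos he2, h]
  · rw [if_neg he2] at h; rw [if_neg he2, if_neg he2, h]

variable [NeZero d]

omit [TopologicalSpace G] [IsTopologicalGroup G] [CompactSpace G] [MeasurableSpace G] [BorelSpace G] in
/-- The torus projection intertwines the site reflections of `ℤ^d` and of the torus (axis `0`). -/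
theorem torusProj_zdSiteReflect (L : ℕ) (x : Site d) :
    Torus.proj L (zdSiteReflect 0 x) = Literature.MathematicalPhysics.QuantumFieldTheory.Site.negReflect (Torus.proj L x) := by
  funext k
  by_cases hk : k = 0
  · subst hk
    simp [Torus.proj, zdSiteReflect, Literature.MathematicalPhysics.QuantumFieldTheory.Site.negReflect]
  · simp [Torus.proj, zdSiteReflect, Literature.MathematicalPhysics.QuantumFieldTheory.Site.negReflect, hk]

omit [TopologicalSpace G] [IsTopologicalGroup G] [CompactSpace G] [MeasurableSpace G] [BorelSpace G] in
/-- The same for the base point of a reflected direction-`0` link. -/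
theorem torusProj_zdSiteReflect_sub (L : ℕ) (x : Site d) :
    Torus.proj L (zdSiteReflect 0 x - Pi.single 0 1) = Literature.MathematicalPhysics.QuantumFieldTheory.Site.negReflect
      (Literature.MathematicalPhysics.QuantumFieldTheory.Site.shift (Torus.proj L x) 0) := by
  funext k
  by_cases hk : k = 0
  · subst hk
    simp [Torus.proj, zdSiteReflect, Literature.MathematicalPhysics.QuantumFieldTheory.Site.negReflect,
      Literature.MathematicalPhysics.QuantumFieldTheory.Site.shift]
    ring
  · simp [Torus.proj, zdSiteReflect, Literature.MathematicalPhysics.QuantumFieldTheory.Site.negReflect,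
      Literature.MathematicalPhysics.QuantumFieldTheory.Site.shift, hk]

omit [TopologicalSpace G] [IsTopologicalGroup G] [CompactSpace G] [MeasurableSpace G] [BorelSpace G] in
/-- **The periodic lift intertwines the axis-`0` reflections**:
`torusLift L (negReflect U) = configSiteReflect 0 (torusLift L U)`. -/
theorem torusLift_negReflect (L : ℕ) (U : GaugeConfig d L G) :
    torusLift L U.negReflect = configSiteReflect 0 (torusLift L U) := by
  funext e
  obtain ⟨x, k⟩ := e
  rw [configSiteReflect_apply]
  simp only [torusLift, Function.comp_apply, torusEdge, GaugeConfig.negReflect]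
  by_cases hk : k = 0
  · subst hk
    simp [torusProj_zdSiteReflect_sub]
  · simp [hk, torusProj_zdSiteReflect]

omit [TopologicalSpace G] [IsTopologicalGroup G] [CompactSpace G] [MeasurableSpace G] [BorelSpace G] in
/-- Observable form of `torusLift_negReflect`. -/
theorem toTorusObservable_comp_configSiteReflect_zero {α : Type*} (L : ℕ) (F : LGConfig d G → α) :
    toTorusObservable L (F ∘ configSiteReflect 0) = toTorusObservable L F ∘ GaugeConfig.negReflect := by
  funext U
  simp only [toTorusObservable, Function.comp_apply, torusLift_negReflect]

variable [T2Space G] [SecondCountableTopology G]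

/-- **Every torus limit point is invariant under the axis-`0` reflection** `configSiteReflect 0`. -/
theorem map_configSiteReflect_zero_eq_of_mem_infiniteVolumeLimitPoints (hρ : Continuous ρ) {β : ℝ}
    {μ : Measure (LGConfig d G)} (hμ : μ ∈ infiniteVolumeLimitPoints (d := d) ρ β) :
    μ.map (configSiteReflect 0) = μ := by
  obtain ⟨φ, hφ, hprob, hconv⟩ := hμ
  haveI := hprob
  have hm : Measurable (configSiteReflect (G := G) (0 : Fin d)) := measurable_configSiteReflect 0
  haveI : IsProbabilityMeasure (μ.map (configSiteReflect (G := G) (0 : Fin d))) :=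
    Measure.isProbabilityMeasure_map hm.aemeasurable
  refine measure_eq_of_integral_cylinder_eq fun F S hFS hFc hFb => ?_
  rw [integral_map hm.aemeasurable hFc.aestronglyMeasurable]
  have h1 := hconv (F ∘ configSiteReflect 0) _ (isCylinder_comp_configSiteReflect hFS 0)
    (hFc.comp (continuous_configSiteReflect 0))
    (by obtain ⟨C, hC⟩ := hFb; exact ⟨C, fun U => hC _⟩)
  have hE : ∀ k : ℕ, wilsonExpectation (L := φ k + 1) ρ β
      (toTorusObservable (φ k + 1) (F ∘ configSiteReflect 0)) =
      wilsonExpectation (L := φ k + 1) ρ β (toTorusObservable (φ k + 1) F) := fun k => by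
    rw [toTorusObservable_comp_configSiteReflect_zero]
    exact integral_comp_negReflect_eq ρ hρ β _
  simp only [hE] at h1
  exact tendsto_nhds_unique h1 (hconv F S hFS hFc hFb)

omit [TopologicalSpace G] [IsTopologicalGroup G] [CompactSpace G] [MeasurableSpace G]
  [BorelSpace G] [T2Space G] [SecondCountableTopology G] in
/-- **A general axis reflection is conjugate to the axis-`0` reflection by the transposition
`(0 i)`**: `configSiteReflect i = configPerm (0 i) ∘ configSiteReflect 0 ∘ configPerm (0 i)`. -/
theorem configSiteReflect_eq_conj (i : Fin d) (U : LGConfig d G) :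
    configSiteReflect i U =
      configPerm (Equiv.swap 0 i) (configSiteReflect 0 (configPerm (Equiv.swap 0 i) U)) := by
  set σ : Equiv.Perm (Fin d) := Equiv.swap 0 i with hσ
  funext e
  obtain ⟨x, k⟩ := e
  have key : ∀ c : ℤ, ((zdSiteReflect 0 (x ∘ ⇑σ) - Pi.single (0 : Fin d) c : Site d) ∘ ⇑σ) =
      (zdSiteReflect i x - Pi.single i c : Site d) := by
    intro c
    funext m
    simp only [hσ, Function.comp_apply, Pi.sub_apply, zdSiteReflect, Function.update_apply,
      Pi.single_apply, Equiv.swap_apply_eq_iff, Equiv.swap_apply_left, Equiv.swap_apply_self]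
  have k0 : (zdSiteReflect 0 (x ∘ ⇑σ) : Site d) ∘ ⇑σ = zdSiteReflect i x := by
    simpa using key 0
  simp only [configPerm, configSiteReflect_apply, hσ, Equiv.symm_swap, Equiv.swap_apply_self,
    Equiv.swap_apply_left, Equiv.swap_apply_eq_iff]
  by_cases hk : k = i
  · rw [if_pos hk, if_pos hk, ← hσ, key 1]
  · rw [if_neg hk, if_neg hk, ← hσ, k0]

/-- **Every torus limit point is invariant under every axis reflection** (measure form). -/
theorem map_configSiteReflect_eq_of_mem_infiniteVolumeLimitPoints (hρ : Continuous ρ) {β : ℝ}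
    {μ : Measure (LGConfig d G)} (hμ : μ ∈ infiniteVolumeLimitPoints (d := d) ρ β) (i : Fin d) :
    μ.map (configSiteReflect i) = μ := by
  have hperm := permInvariant_of_mem_infiniteVolumeLimitPoints ρ hρ hμ (Equiv.swap 0 i)
  have h0 : MeasurePreserving (configSiteReflect (G := G) (0 : Fin d)) μ μ :=
    ⟨measurable_configSiteReflect 0, map_configSiteReflect_zero_eq_of_mem_infiniteVolumeLimitPoints ρ hρ hμ⟩
  have heq : (configSiteReflect (G := G) i : LGConfig d G → LGConfig d G) =
      configPerm (Equiv.swap 0 i) ∘ configSiteReflect 0 ∘ configPerm (Equiv.swap 0 i) :=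
    funext fun U => configSiteReflect_eq_conj i U
  rw [heq]
  exact ((hperm.comp h0).comp hperm).map_eq

/-- **`reflectInvariant` for torus limit points**: every infinite-volume limit point of the torus
Wilson states is invariant under the axis reflections `configSiteReflect i` of `ClassB.lean`. -/
theorem reflectInvariant_of_mem_infiniteVolumeLimitPoints (hρ : Continuous ρ) {β : ℝ}
    {μ : Measure (LGConfig d G)} (hμ : μ ∈ infiniteVolumeLimitPoints (d := d) ρ β) (i : Fin d) :
    MeasurePreserving (configSiteReflect i) μ μ :=
  ⟨measurable_configSiteReflect i, map_configSiteReflect_eq_of_mem_infiniteVolumeLimitPoints ρ hρ hμ i⟩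

end Reflect

end Summit.QuantumFields.GaugeBoot
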